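import Mathlib
import Literature.NumberTheory.LFunctions.MatomakiRadziwillTaoTheorem13
import Literature.NumberTheory.LFunctions.SemimultiplicativeMoebiusPeriodic
import Literature.NumberTheory.Sieve.RamanujanSum
import Summits.QuantumAdvantage.QuantumAdvantage.Theorems.MobiusLadderQuadraticDigitPhasesStubMomoAPBlocks

/-!
# `QuadraticDigitPhases` (stmt-QuantumAdvantage-1391), line `Sketch` — stub `stub_momoAP`

Banded branch of the crux, almost-periodic sub-branch: for an almost periodic (Konieczny 2020,
Definition 2.2, `Literature.NumberTheory.LFunctions.Konieczny.IsAlmostPeriodic`) `1`-bounded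
`f : ℕ → ℂ` the dyadic block statistic
`BS(k, n) = Σ_{b<2^{n-k}} |Σ_{a<2^k} λ(2^k b + a) f(2^k b + a)|` is `o(2^n)` — eventually in `k`,
then eventually in `n` — given Matomäki–Radziwiłł–Tao 2015, Theorem 1.3
(`Literature.NumberTheory.LFunctions.Tao2016.MatomakiRadziwillTao2015_theorem13`, a hypothesis
here; it is proved in the tree).

Proof (`stub_momoAP`). Step 1 is the block lemma `liouville_phase_blocks` of
`MobiusLadderQuadraticDigitPhasesStubMomoAPBlocks.lean`: the block statistic of `λ(m) e(αm)` is
`≤ δ 2^n` uniformly in `α`. Step 2 (this file), as in the proof of Konieczny's Lemma 2.3: given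
`ε`, almost periodicity with `ε/6` gives a period `Q` and, for `N = 2^n`, a `Q`-periodic
`1`-bounded `g_N` with `Σ_{m<N} |f(m) - g_N(m)| ≤ (ε/2) N` (`sum_norm_sub_le`); expanding
`g_N(m) = Σ_{t<Q} c_t e(tm/Q)` with `|c_t| ≤ 1` (finite Fourier inversion, `periodic_eq_sum_e`,
from the orthogonality relation `Literature.NumberTheory.Sieve.RamanujanSum.sum_range_fourierChar_div`)
bounds `BS_{g_N}` by `Σ_{t<Q}` of the block statistics of `λ e(t·/Q)` (`sum_blocks_le_of_expansion`),
each `≤ (ε/2Q) 2^n` by Step 1. Only `Q = Q(ε)` enters the thresholds, not `g_N`.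
-/

set_option linter.dupNamespace false -- D-0017: single-problem summit ⇒ `QuantumAdvantage.QuantumAdvantage` by design

namespace Summit.QuantumAdvantage.QuantumAdvantage.Theorems.MobiusLadderQuadraticDigitPhasesStubMomoAP

open Finset Filter
open Literature.NumberTheory.LFunctions
open Summit.QuantumAdvantage.QuantumAdvantage.Theorems.MobiusLadderQuadraticDigitPhasesStubMomoAPBlocks
  (sum_range_mul_eq_sum_sum liouville_phase_blocks)

/-! ### Finite Fourier inversion for periodic sequences -/

/-- **Finite Fourier inversion.** A `Q`-periodic `1`-bounded `g : ℕ → ℂ` is a combination of the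
`Q` additive characters, `g(m) = Σ_{t<Q} c_t e(t m / Q)` with
`c_t = Q⁻¹ Σ_{r<Q} g(r) e(-t r / Q)`, `|c_t| ≤ 1` (`e(x) = exp(2πix)` is
`Literature.NumberTheory.LFunctions.VdC.e`, definitionally Mathlib's `Real.fourierChar`; the
orthogonality relation is the tree's `Literature.NumberTheory.Sieve.RamanujanSum.sum_range_fourierChar_div`).
[folklore] -/
theorem periodic_eq_sum_e {Q : ℕ} (hQ : 0 < Q) {g : ℕ → ℂ} (hg : Function.Periodic g Q)
    (hg1 : ∀ n, ‖g n‖ ≤ 1) :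
    ∃ c : ℕ → ℂ, (∀ t, ‖c t‖ ≤ 1) ∧
      ∀ m : ℕ, g m = ∑ t ∈ range Q, c t * VdC.e ((t : ℝ) / Q * m) := by
  have hQr : (0 : ℝ) < Q := by exact_mod_cast hQ
  have hQc : (Q : ℂ) ≠ 0 := by exact_mod_cast hQ.ne'
  refine ⟨fun t => (Q : ℂ)⁻¹ * ∑ r ∈ range Q, g r * VdC.e (-((t : ℝ) / Q * r)),
    fun t => ?_, fun m => ?_⟩
  · rw [norm_mul, norm_inv, Complex.norm_natCast, inv_mul_le_iff₀ hQr, mul_one]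
    calc ‖∑ r ∈ range Q, g r * VdC.e (-((t : ℝ) / Q * r))‖
        ≤ ∑ r ∈ range Q, ‖g r * VdC.e (-((t : ℝ) / Q * r))‖ := norm_sum_le _ _
      _ ≤ ∑ r ∈ range Q, (1 : ℝ) := Finset.sum_le_sum fun r _ => by
          rw [norm_mul, VdC.norm_e, mul_one]; exact hg1 r
      _ = Q := by simp
  · have hterm : ∀ t r : ℕ, g r * VdC.e (-((t : ℝ) / Q * r)) * VdC.e ((t : ℝ) / Q * m) =
        g r * VdC.e ((t : ℝ) * (((m : ℤ) - r : ℤ) : ℝ) / Q) := by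
      intro t r
      rw [mul_assoc, ← VdC.e_add]
      congr 2
      push_cast
      ring
    symm
    calc ∑ t ∈ range Q, (Q : ℂ)⁻¹ * (∑ r ∈ range Q, g r * VdC.e (-((t : ℝ) / Q * r)))
          * VdC.e ((t : ℝ) / Q * m)
        = (Q : ℂ)⁻¹ * ∑ t ∈ range Q, ∑ r ∈ range Q,
            g r * VdC.e ((t : ℝ) * (((m : ℤ) - r : ℤ) : ℝ) / Q) := by
          rw [Finset.mul_sum]
          refine Finset.sum_congr rfl fun t _ => ?_
          rw [mul_assoc, Finset.sum_mul]
          exact congrArg _ (Finset.sum_congr rfl fun r _ => hterm t r)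
      _ = (Q : ℂ)⁻¹ * ∑ r ∈ range Q, g r *
            ∑ t ∈ range Q, VdC.e ((t : ℝ) * (((m : ℤ) - r : ℤ) : ℝ) / Q) := by
          rw [Finset.sum_comm]
          simp_rw [Finset.mul_sum]
      _ = (Q : ℂ)⁻¹ * ∑ r ∈ range Q, g r * (if (Q : ℤ) ∣ ((m : ℤ) - r) then (Q : ℂ) else 0) := by
          congr 1
          refine Finset.sum_congr rfl fun r _ => ?_
          congr 1
          exact Literature.NumberTheory.Sieve.RamanujanSum.sum_range_fourierChar_div hQ.ne' _
      _ = (Q : ℂ)⁻¹ * (g (m % Q) * Q) := by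
          congr 1
          rw [Finset.sum_eq_single_of_mem (m % Q) (Finset.mem_range.2 (Nat.mod_lt m hQ))]
          · rw [if_pos (Nat.modEq_iff_dvd.1 (Nat.mod_modEq m Q))]
          · intro r hr hne
            rw [if_neg, mul_zero]
            intro hdvd
            apply hne
            have h1 : r % Q = m % Q := Nat.modEq_iff_dvd.2 hdvd
            rwa [Nat.mod_eq_of_lt (Finset.mem_range.1 hr)] at h1
      _ = g m := by
          rw [hg.map_mod_nat]
          field_simp

/-! ### Step 2: reduction to the block lemma -/

/-- The `ℓ¹` error of an `ε`-approximation off an `ε`-small set (as in Konieczny 2020, proof of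
Lemma 2.3): if `|f|, |g| ≤ 1` and `#{m < N : ε < |f(m) - g(m)|} ≤ ε N` then
`Σ_{m<N} |f(m) - g(m)| ≤ 3 ε N`. [cite: Konieczny2020, Lemma 2.3] -/
theorem sum_norm_sub_le {f g : ℕ → ℂ} (hf : ∀ m, ‖f m‖ ≤ 1) (hg : ∀ m, ‖g m‖ ≤ 1) {ε : ℝ}
    (hε : 0 ≤ ε) (N : ℕ)
    (hcard : (((range N).filter (fun m => ε < ‖f m - g m‖)).card : ℝ) ≤ ε * N) :
    ∑ m ∈ range N, ‖f m - g m‖ ≤ 3 * ε * N := by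
  -- adapted from `Literature.NumberTheory.LFunctions.Konieczny.IsAlmostPeriodic.tendsto_moebius`
  calc ∑ m ∈ range N, ‖f m - g m‖
      ≤ ∑ m ∈ range N, (ε + if ε < ‖f m - g m‖ then (2 : ℝ) else 0) :=
        Finset.sum_le_sum fun m _ => Konieczny.norm_sub_le_eps_add_ite (hf m) (hg m) ε hε
    _ = ε * N + 2 * (((range N).filter (fun m => ε < ‖f m - g m‖)).card : ℝ) := by
        rw [Finset.sum_add_distrib, Finset.sum_const, Finset.card_range, nsmul_eq_mul,
          ← Finset.sum_filter, Finset.sum_const, nsmul_eq_mul]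
        ring
    _ ≤ ε * N + 2 * (ε * N) := by gcongr
    _ = 3 * ε * N := by ring

/-- **Blocks of `w·f` versus blocks of `w·e(t·/Q)`.** If `|w| ≤ 1` and
`g(m) = Σ_{t<Q} c_t e(t m/Q)` with `|c_t| ≤ 1`, then for blocks of length `H`,
`Σ_{b<B} |Σ_{a<H} w f| ≤ Σ_{m<HB} |f(m) - g(m)| + Σ_{t<Q} Σ_{b<B} |Σ_{a<H} w e(t·/Q)|`
(all sequences evaluated at `m = Hb + a`). [folklore] -/
theorem sum_blocks_le_of_expansion {w f g : ℕ → ℂ} (hw : ∀ m, ‖w m‖ ≤ 1) {Q : ℕ} {c : ℕ → ℂ}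
    (hc1 : ∀ t, ‖c t‖ ≤ 1) (hgc : ∀ m : ℕ, g m = ∑ t ∈ range Q, c t * VdC.e ((t : ℝ) / Q * m))
    (H B : ℕ) :
    ∑ b ∈ range B, ‖∑ a ∈ range H, w (H * b + a) * f (H * b + a)‖ ≤
      ∑ m ∈ range (H * B), ‖f m - g m‖ +
        ∑ t ∈ range Q, ∑ b ∈ range B,
          ‖∑ a ∈ range H, w (H * b + a) * VdC.e ((t : ℝ) / Q * ((H * b + a : ℕ) : ℝ))‖ := by
  -- one block: `w f = w (f - g) + Σ_t c_t (w e_t)`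
  have hblock : ∀ b : ℕ, ‖∑ a ∈ range H, w (H * b + a) * f (H * b + a)‖ ≤
      ∑ a ∈ range H, ‖f (H * b + a) - g (H * b + a)‖ +
        ∑ t ∈ range Q,
          ‖∑ a ∈ range H, w (H * b + a) * VdC.e ((t : ℝ) / Q * ((H * b + a : ℕ) : ℝ))‖ := by
    intro b
    have h2 : ∀ a : ℕ, w (H * b + a) * g (H * b + a) =
        ∑ t ∈ range Q, c t * (w (H * b + a) * VdC.e ((t : ℝ) / Q * ((H * b + a : ℕ) : ℝ))) := by
      intro a
      rw [hgc (H * b + a), Finset.mul_sum]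
      exact Finset.sum_congr rfl fun t _ => by ring
    have hdecomp : ∑ a ∈ range H, w (H * b + a) * f (H * b + a) =
        ∑ a ∈ range H, w (H * b + a) * (f (H * b + a) - g (H * b + a)) +
          ∑ t ∈ range Q, c t *
            ∑ a ∈ range H, w (H * b + a) * VdC.e ((t : ℝ) / Q * ((H * b + a : ℕ) : ℝ)) := by
      calc ∑ a ∈ range H, w (H * b + a) * f (H * b + a)
          = ∑ a ∈ range H, (w (H * b + a) * (f (H * b + a) - g (H * b + a))
              + w (H * b + a) * g (H * b + a)) :=
            Finset.sum_congr rfl fun a _ => by ring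
        _ = ∑ a ∈ range H, w (H * b + a) * (f (H * b + a) - g (H * b + a)) +
              ∑ a ∈ range H, ∑ t ∈ range Q,
                c t * (w (H * b + a) * VdC.e ((t : ℝ) / Q * ((H * b + a : ℕ) : ℝ))) := by
            rw [Finset.sum_add_distrib]
            exact congrArg _ (Finset.sum_congr rfl fun a _ => h2 a)
        _ = _ := by
            congr 1
            rw [Finset.sum_comm]
            exact Finset.sum_congr rfl fun t _ => by rw [Finset.mul_sum]
    rw [hdecomp]
    refine (norm_add_le _ _).trans (add_le_add ?_ ?_)
    · refine (norm_sum_le _ _).trans (Finset.sum_le_sum fun a _ => ?_)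
      rw [norm_mul]
      calc ‖w (H * b + a)‖ * ‖f (H * b + a) - g (H * b + a)‖
          ≤ 1 * ‖f (H * b + a) - g (H * b + a)‖ :=
            mul_le_mul_of_nonneg_right (hw _) (norm_nonneg _)
        _ = _ := one_mul _
    · refine (norm_sum_le _ _).trans (Finset.sum_le_sum fun t _ => ?_)
      rw [norm_mul]
      calc ‖c t‖ * ‖∑ a ∈ range H, w (H * b + a) * VdC.e ((t : ℝ) / Q * ((H * b + a : ℕ) : ℝ))‖
          ≤ 1 * ‖∑ a ∈ range H, w (H * b + a) * VdC.e ((t : ℝ) / Q * ((H * b + a : ℕ) : ℝ))‖ :=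
            mul_le_mul_of_nonneg_right (hc1 t) (norm_nonneg _)
        _ = _ := one_mul _
  calc ∑ b ∈ range B, ‖∑ a ∈ range H, w (H * b + a) * f (H * b + a)‖
      ≤ ∑ b ∈ range B, (∑ a ∈ range H, ‖f (H * b + a) - g (H * b + a)‖ +
          ∑ t ∈ range Q,
            ‖∑ a ∈ range H, w (H * b + a) * VdC.e ((t : ℝ) / Q * ((H * b + a : ℕ) : ℝ))‖) :=
        Finset.sum_le_sum fun b _ => hblock b
    _ = ∑ b ∈ range B, ∑ a ∈ range H, ‖f (H * b + a) - g (H * b + a)‖ +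
          ∑ b ∈ range B, ∑ t ∈ range Q,
            ‖∑ a ∈ range H, w (H * b + a) * VdC.e ((t : ℝ) / Q * ((H * b + a : ℕ) : ℝ))‖ :=
        Finset.sum_add_distrib
    _ = _ := by
        rw [sum_range_mul_eq_sum_sum (fun m => ‖f m - g m‖) H B]
        congr 1
        exact Finset.sum_comm

/-- **Stub `stub_momoAP`** (line `Sketch` of `QuadraticDigitPhases`): for every almost periodic
`1`-bounded `f : ℕ → ℂ` and `ε > 0`, eventually in `k` and then eventually in `n`,
`Σ_{b<2^{n-k}} |Σ_{a<2^k} λ(2^k b + a) f(2^k b + a)| ≤ ε 2^n`, assuming Matomäki–Radziwiłł–Tao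
2015, Theorem 1.3. Proof: Konieczny 2020, Lemma 2.3 with the periodic case replaced by the finite
Fourier expansion of the approximant (`periodic_eq_sum_e`, `sum_blocks_le_of_expansion`,
`sum_norm_sub_le`) and the block lemma `liouville_phase_blocks` (MRT Theorem 1.3 discretised to
dyadic blocks) applied with `δ = ε/(2Q)` at the `Q` frequencies `t/Q`.
[cite: Konieczny2020, Lemma 2.3] -/
theorem stub_momoAP
    (hMRT : Literature.NumberTheory.LFunctions.Tao2016.MatomakiRadziwillTao2015_theorem13) :
    ∀ f : ℕ → ℂ, Literature.NumberTheory.LFunctions.Konieczny.IsAlmostPeriodic f →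
      (∀ m, ‖f m‖ ≤ 1) →
      ∀ ε : ℝ, 0 < ε → ∀ᶠ k : ℕ in atTop, ∀ᶠ n : ℕ in atTop,
        ∑ b ∈ range (2 ^ (n - k)),
          ‖∑ a ∈ range (2 ^ k), ((ArithmeticFunction.liouville (2 ^ k * b + a) : ℤ) : ℂ) *
            f (2 ^ k * b + a)‖ ≤ ε * (2 : ℝ) ^ n := by
  intro f hf hb ε hε
  obtain ⟨Q, hQ, hg⟩ := hf (ε / 6) (by positivity)
  have hQr : (0 : ℝ) < Q := by exact_mod_cast hQ
  have hQne : (Q : ℝ) ≠ 0 := hQr.ne'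
  have hδ0 : 0 < ε / (2 * Q) := by positivity
  have hL : ∀ m : ℕ, ‖((ArithmeticFunction.liouville m : ℤ) : ℂ)‖ ≤ 1 := fun m => by
    rw [← ArithmeticFunction.intCoe_apply]; exact norm_liouville_complex_le_one m
  filter_upwards [liouville_phase_blocks hMRT hδ0] with k hk
  filter_upwards [hk, eventually_ge_atTop k] with n hn hkn
  obtain ⟨g, hgper, hg1, hcard⟩ := hg (2 ^ n)
  obtain ⟨c, hc1, hgc⟩ := periodic_eq_sum_e hQ hgper hg1
  have hHB : 2 ^ k * 2 ^ (n - k) = 2 ^ n := by rw [← pow_add, Nat.add_sub_of_le hkn]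
  have hNreal : ((2 ^ n : ℕ) : ℝ) = (2 : ℝ) ^ n := by push_cast; ring
  have h1 : ∑ m ∈ range (2 ^ k * 2 ^ (n - k)), ‖f m - g m‖ ≤ 3 * (ε / 6) * (2 : ℝ) ^ n := by
    rw [hHB, ← hNreal]
    exact sum_norm_sub_le hb hg1 (by positivity) (2 ^ n) hcard
  have h2 : ∑ t ∈ range Q, ∑ b ∈ range (2 ^ (n - k)),
      ‖∑ a ∈ range (2 ^ k), ((ArithmeticFunction.liouville (2 ^ k * b + a) : ℤ) : ℂ) *
        VdC.e ((t : ℝ) / Q * ((2 ^ k * b + a : ℕ) : ℝ))‖ ≤ Q * (ε / (2 * Q) * (2 : ℝ) ^ n) := by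
    calc _ ≤ ∑ t ∈ range Q, ε / (2 * Q) * (2 : ℝ) ^ n :=
          Finset.sum_le_sum fun t _ => hn ((t : ℝ) / Q)
      _ = Q * (ε / (2 * Q) * (2 : ℝ) ^ n) := by
          rw [Finset.sum_const, Finset.card_range, nsmul_eq_mul]
  refine (sum_blocks_le_of_expansion (f := f)
    (w := fun m => ((ArithmeticFunction.liouville m : ℤ) : ℂ)) hL hc1 hgc (2 ^ k) (2 ^ (n - k))).trans ?_
  refine (add_le_add h1 h2).trans (le_of_eq ?_)
  field_simp
  ring

end Summit.QuantumAdvantage.QuantumAdvantage.Theorems.MobiusLadderQuadraticDigitPhasesStubMomoAP
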